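import Mathlib

/-!
# Peripheral elements of the trefoil group are non-trivial — a kernel certificate

Load-bearing group fact behind the no-go 11.18(g)(6) of the solo-informed programme
("no Seifert solid Klein bottle of the c-spun trefoil Klein bottle avoids the belt sphere"):
in the trefoil group `G = ⟨x, y | x² = y³⟩` with meridian `μ = x⁻¹ y` and longitude
`λ = x² μ⁻⁶`, every push-off `λ μᵏ` (`k : ℤ`) is a non-trivial element.  The certificate is the
representation `x ↦ S`, `y ↦ S T` into `SL(2, ℤ)`, under which `μ ↦ T` and `λ μᵏ ↦ -T^(k-6)`,
whose `(1,1)` entry is `-1`.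
-/

namespace Summit.SmoothPoincare4.SmoothPoincare4.Theorems
namespace TrefoilPeripheral

open Matrix ModularGroup MatrixGroups

/-- The single relator `x² y⁻³` of the trefoil group on generators `0 ↦ x`, `1 ↦ y`. -/
def trefoilRel : FreeGroup (Fin 2) := FreeGroup.of 0 ^ 2 * (FreeGroup.of 1 ^ 3)⁻¹

/-- The relator set of the trefoil group. -/
def trefoilRels : Set (FreeGroup (Fin 2)) := {trefoilRel}

/-- The trefoil group `⟨x, y | x² = y³⟩`. -/
abbrev TrefoilGroup : Type := PresentedGroup trefoilRels

/-- The generator `x` (order-2 exceptional fibre class). -/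
def gx : TrefoilGroup := PresentedGroup.of 0
/-- The generator `y` (order-3 exceptional fibre class). -/
def gy : TrefoilGroup := PresentedGroup.of 1
/-- A meridian of the trefoil. -/
def mer : TrefoilGroup := gx⁻¹ * gy
/-- The preferred longitude `x² μ⁻⁶` (it commutes with `μ` because `x²` is central). -/
def lon : TrefoilGroup := gx ^ 2 * mer ^ (-6 : ℤ)

/-- Images of the generators in `SL(2, ℤ)`: `x ↦ S`, `y ↦ S T`. -/
def genImg : Fin 2 → SL(2, ℤ) := ![S, S * T]

/-- `S² = -1` in `SL(2, ℤ)`. -/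
lemma S_sq_eq : (S : SL(2, ℤ)) ^ 2 = -1 := by
  ext i j
  fin_cases i <;> fin_cases j <;> simp [S, pow_two, Matrix.mul_apply, Fin.sum_univ_two]

/-- `(S T)³ = -1` in `SL(2, ℤ)`. -/
lemma ST_cube_eq : ((S : SL(2, ℤ)) * T) ^ 3 = -1 := by
  ext i j
  fin_cases i <;> fin_cases j <;>
    simp [S, T, pow_succ, Matrix.mul_apply, Fin.sum_univ_two]

/-- The relator `x² y⁻³` maps to `1` under `x ↦ S`, `y ↦ S T`. -/
lemma lift_rel : FreeGroup.lift genImg trefoilRel = 1 := by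
  simp only [trefoilRel, map_mul, map_pow, map_inv, FreeGroup.lift_apply_of, genImg,
    Matrix.cons_val_zero, Matrix.cons_val_one]
  rw [S_sq_eq, ST_cube_eq]
  simp

/-- The representation `ρ : G → SL(2, ℤ)`. -/
def rho : TrefoilGroup →* SL(2, ℤ) :=
  PresentedGroup.toGroup (f := genImg) (by
    intro r hr
    simp only [trefoilRels, Set.mem_singleton_iff] at hr
    subst hr
    exact lift_rel)

/-- `ρ x = S`. -/
lemma rho_gx : rho gx = S := by
  simp [rho, gx, genImg]

/-- `ρ y = S T`. -/
lemma rho_gy : rho gy = S * T := by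
  simp [rho, gy, genImg]

/-- `ρ μ = T`. -/
lemma rho_mer : rho mer = T := by
  simp [mer, map_mul, map_inv, rho_gx, rho_gy]

/-- `ρ (λ μᵏ) = -T^(k-6)`. -/
lemma rho_lon_mul_mer_zpow (k : ℤ) : rho (lon * mer ^ k) = -(T ^ (k - 6)) := by
  simp only [lon, map_mul, map_pow, map_zpow, rho_gx, rho_mer, S_sq_eq, one_mul, neg_mul,
    ← _root_.zpow_add]
  rw [show (-6 : ℤ) + k = k - 6 by ring]

/-- CERTIFICATE: every push-off `λ μᵏ` of the trefoil is a non-trivial element of the trefoil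
group (its image in `SL(2, ℤ)` has `(1,1)` entry `-1`). -/
theorem lon_mul_mer_zpow_ne_one (k : ℤ) : lon * mer ^ k ≠ 1 := by
  intro h
  have h1 : rho (lon * mer ^ k) = 1 := by rw [h, map_one]
  rw [rho_lon_mul_mer_zpow] at h1
  have h2 := congrArg (fun g : SL(2, ℤ) => (g : Matrix (Fin 2) (Fin 2) ℤ) 0 0) h1
  simp [ModularGroup.coe_T_zpow] at h2

/-- In particular the longitude itself is non-trivial. -/
theorem lon_ne_one : lon ≠ 1 := by
  simpa using lon_mul_mer_zpow_ne_one 0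

/-- And the meridian has infinite order: `μᵏ ≠ 1` for `k ≠ 0`. -/
theorem mer_zpow_ne_one {k : ℤ} (hk : k ≠ 0) : mer ^ k ≠ 1 := by
  intro h
  have h1 : rho (mer ^ k) = 1 := by rw [h, map_one]
  rw [map_zpow, rho_mer] at h1
  have h2 := congrArg (fun g : SL(2, ℤ) => (g : Matrix (Fin 2) (Fin 2) ℤ) 0 1) h1
  simp [ModularGroup.coe_T_zpow] at h2
  exact hk h2

end TrefoilPeripheral
end Summit.SmoothPoincare4.SmoothPoincare4.Theorems
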